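import Summits.ResolutionOfSingularities.ResolutionOfSingularities.Theorems.MarkedTransferCampaignW23Thm918FlagChains
import Summits.ResolutionOfSingularities.ResolutionOfSingularities.Theorems.MarkedTransferCampaignW23TailInMSquareProof
import Summits.ResolutionOfSingularities.ResolutionOfSingularities.Theorems.MarkedTransferCampaignW23FlagDescentBookkeeping
import Literature.AlgebraicGeometry.Hironaka2017.Proofs.S09.Thm918
import HarnessLib

/-!
# [OURS · L1 W2.3] Th. 9.18 BY NAME for the flag chains — PROOFS of the statements of
# `Theorems/MarkedTransferCampaignW23Thm918FlagChains.lean`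
# (RESCUE-SEED slot W2.3 «tails without `H♭`», group L-G2; cell `res-hironaka`, rung L of LADDER-RESOLUTION)

HONEST FRAMING. Everything here is OURS (campaign statements of the cell `res-hironaka` and their kernel proofs);
NOTHING is a statement of H. Hironaka's manuscript [Hironaka2017] and nothing is attributed to its author; the typed
carriers of rung S (`S16Proof.InductionInput`, `S09LLUED.LLChainHead` / `LLChainData` / `Thm9_18`, row 006's
`cotLocal_ours` / `cotVec_ours`) enter only as parameters / hypotheses. AI review is weaker than expert review.

PROVED HERE (0 `sorry`, axioms ⊆ {propext, Classical.choice, Quot.sound}):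
* `knockOutOrderDescent_holds p : KnockOutOrderDescent p` — the recipe-free engine: for ANY descent
  `c j = c(j+1)^p + h(j)` from `c 0 = y^{p^e} + ε` (`ord ε > p^e`) whose knock-outs satisfy only the ORDER PART of
  Eq. (84) (5) «ord h(j) > p^{e−j}», `ord(c j − y^{p^{e−j}}) > p^{e−j}` for all `j ≤ e` (regular local ring;
  `(c(j+1) − y^{p^{e−j−1}})^p = (c j − y^{p^{e−j}}) − h(j)`, `ord(f^p) = p·ord f`).
* `chainOrderClausesDerived_holds p : ChainOrderClausesDerived p` — on the typed `LLChainData`: headed-by + the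
  second equation of (84) (1) + the order part of (84) (5) give Th. 9.18 (1)'s first clause `g(e) − y ∈ max²` and
  `ord g(j) = p^{e−j}` ((84) (3)/(6)/(7)), with no use of (84) (8) / «y(j) = y».
* `IsFlagChainSeq.flagDescent_rev`, `.rev_top`, `.mem_theta_ours`, `.tail_mem_theta_ours_zero`, `.tail_sub_y_mem_sq`
  — a flag chain read upwards is a `FlagDescent` (p461945) from the head datum's `y^q + ϵ(0)`; its members lie in
  the flag (`mem_theta_ours_of_flagDescent`, p464759), its tail in `Θ(Ě,q(0))` and in `y + max²`
  (`flagDescent_sub_pow_mem`, p466324).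
* `thm918ForFlagChains_holds p : Thm918ForFlagChains p` and `thm918ForFlagChainsCotVec_holds p :
  Thm918ForFlagChainsCotVec p` — the typed `S09LLUED.Thm9_18` (row 062) HOLDS at the flag chains with
  `℘̃ := Θ(Ě,q(0))` and any `𝔳` linked to `cot` (resp. row 006's carriers), NO GAP binder; part (2) via the discharge
  lane's `toCotangent_ne_zero_and_mem_of_sub_mem_sq` (p469679).

## References
* Tree (OURS): `Theorems/MarkedTransferCampaignW23Thm918FlagChains.lean` (statements), `…TailInMSquare.lean` (p461945),
  `…TailInMSquareProof.lean` (p466324), `…FlagDescentBookkeeping.lean` (p464759); `Literature/…/Proofs/S09/Thm918.lean`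
  (p469679); `Literature/…/S09LLUED/R060LLChainSetup.lean`, `R061LLChain.lean`, `R062Thm918.lean`;
  `Literature/…/S04CharAlgebra/R006aCotCarrier.lean`. Cell files: plan/RESCUE-SEED.md §1 L-G2 W2.3; L/SLOTS.md §2 W2.3;
  ledger/group-2/DOSSIER.md §3 (INDEX ONLY).
* H. Hironaka, ms. 2017-03-23: Eq. (82)–(84) p.54 L30 – p.55 L39, Th. 9.18 p.55 L34–L37, Def. 4.14/4.15 p.22, §16.4
  Def. 16.15/16.16 p.88 — scope only, under adjudication, not cited as fact. [Hironaka2017]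
-/

set_option linter.dupNamespace false -- mandated namespace of this single-conjunct summit

namespace Summit.ResolutionOfSingularities.ResolutionOfSingularities.Theorems

namespace CampaignW23

open Literature.AlgebraicGeometry.Hironaka2017.S16Proof
open Literature.AlgebraicGeometry.Hironaka2017.S09LLUED
open Literature.AlgebraicGeometry.Hironaka2017.S04CharAlgebra (cotLocal_ours cotVec_ours)
open Literature.AlgebraicGeometry.Resolution
open IsLocalRing

universe u

/-! ### Order lemmas in a local ring / a regular local ring -/

section OrderLemmas

variable {O : Type u} [CommRing O]

/-- `n < ord f` iff `f ∈ 𝔪ⁿ⁺¹` (restatement of `le_adicOrder_iff`). [folklore] -/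
theorem lt_adicOrder_iff_mem_pow_succ [IsLocalRing O] (f : O) (n : ℕ) :
    (n : ℕ∞) < adicOrder f ↔ f ∈ maximalIdeal O ^ (n + 1) := by
  rw [← le_adicOrder_iff, Nat.cast_add, Nat.cast_one]
  constructor
  · exact fun h => Order.add_one_le_of_lt h
  · intro h
    exact lt_of_lt_of_le (ENat.lt_add_one_iff (ENat.coe_ne_top n) |>.mpr le_rfl) h

/-- `ord(a + r) = n` when `ord a = n` and `ord r > n` (any local ring). [folklore] -/
theorem adicOrder_add_eq_of_lt [IsLocalRing O] {a r : O} {n : ℕ} (ha : adicOrder a = n)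
    (hr : (n : ℕ∞) < adicOrder r) : adicOrder (a + r) = n := by
  have hr' : r ∈ maximalIdeal O ^ (n + 1) := (lt_adicOrder_iff_mem_pow_succ r n).mp hr
  apply le_antisymm
  · rw [adicOrder_le_iff]
    intro har
    have ha' : a ∈ maximalIdeal O ^ (n + 1) := by
      have : a = (a + r) - r := by ring
      rw [this]
      exact Ideal.sub_mem _ har hr'
    have := (adicOrder_le_iff a n).mp ha.le
    exact this ha'
  · rw [le_adicOrder_iff]
    have ha2 : a ∈ maximalIdeal O ^ n := (le_adicOrder_iff a n).mp ha.ge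
    exact Ideal.add_mem _ ha2 (Ideal.pow_le_pow_right (Nat.le_succ n) hr')

end OrderLemmas

/-! ### The recipe-free engine -/

/-- [OURS · L1 W2.3] `KnockOutOrderDescent p` HOLDS for every prime `p`. [folklore] -/
theorem knockOutOrderDescent_holds (p : ℕ) [Fact p.Prime] : KnockOutOrderDescent p := by
  intro O _ _ _ e y ε c hε hc0 hko
  -- membership form, by induction on the step index `j`, with `i = e - j`
  have key : ∀ j i : ℕ, i + j = e → c j - y ^ p ^ i ∈ maximalIdeal O ^ (p ^ i + 1) := by
    intro j
    induction j with
    | zero =>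
      intro i hi
      rw [add_zero] at hi
      subst hi
      rw [hc0, add_sub_cancel_left]
      exact (lt_adicOrder_iff_mem_pow_succ ε _).mp hε
    | succ j ih =>
      intro i hi
      have h1 : c j - y ^ p ^ (i + 1) ∈ maximalIdeal O ^ (p ^ (i + 1) + 1) := ih (i + 1) (by omega)
      have h2 : c j - c (j + 1) ^ p ∈ maximalIdeal O ^ (p ^ (i + 1) + 1) := by
        have := hko j (by omega)
        rw [show e - j = i + 1 by omega] at this
        exact (lt_adicOrder_iff_mem_pow_succ _ _).mp this
      have h3 : (c (j + 1) - y ^ p ^ i) ^ p ∈ maximalIdeal O ^ (p * p ^ i + 1) := by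
        rw [sub_pow_char, ← pow_mul, ← pow_succ, ← pow_succ']
        have : c (j + 1) ^ p - y ^ p ^ (i + 1) = (c j - y ^ p ^ (i + 1)) - (c j - c (j + 1) ^ p) := by ring
        rw [this]
        exact Ideal.sub_mem _ h1 h2
      exact mem_pow_succ_of_pow_mem _ _ h3
  intro j hj
  rw [lt_adicOrder_iff_mem_pow_succ]
  exact key j (e - j) (by omega)

/-! ### The typed chain: the order clauses follow from (84)(1) + the order part of (84)(5) -/

/-- [OURS · L1 W2.3] `ChainOrderClausesDerived p` HOLDS for every prime `p`. [folklore] -/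
theorem chainOrderClausesDerived_holds (p : ℕ) [Fact p.Prime] : ChainOrderClausesDerived p := by
  intro O _ _ _ frakL cot IsGCleaned D d hH h1 h5
  obtain ⟨he, hg0, -, -⟩ := hH
  -- the engine applied to `c := d.g`
  have hc0 : d.g 0 = D.y ^ p ^ d.e + D.ε0 := by
    rw [hg0, he]; rfl
  have hε : ((p ^ d.e : ℕ) : ℕ∞) < adicOrder D.ε0 := by rw [he]; exact D.ord_ε0
  have hko : ∀ j : ℕ, j < d.e → ((p ^ (d.e - j) : ℕ) : ℕ∞) < adicOrder (d.g j - d.g (j + 1) ^ p) := by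
    intro j hj
    have hstep := h1 (d.e - j) j (by omega) (by omega)
    have : d.g j - d.g (j + 1) ^ p = d.h j := by rw [hstep]; ring
    rw [this]
    exact h5 (d.e - j) j (by omega) (by omega)
  have eng := knockOutOrderDescent_holds p O d.e D.y D.ε0 d.g hε hc0 hko
  refine ⟨?_, ?_⟩
  · -- j = e
    have h := eng d.e le_rfl
    rw [Nat.sub_self, pow_zero, pow_one] at h
    rw [← he]
    have h' := (lt_adicOrder_iff_mem_pow_succ _ 1).mp (by exact_mod_cast h)
    simpa using h'
  · intro i j hij
    have h := eng j (by omega)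
    rw [show d.e - j = i by omega] at h
    have hy : adicOrder (D.y ^ p ^ i) = ((p ^ i : ℕ) : ℕ∞) := by
      rw [adicOrder_pow, D.ord_y, mul_one]
    have : d.g j = D.y ^ p ^ i + (d.g j - D.y ^ p ^ i) := by ring
    rw [this]
    exact adicOrder_add_eq_of_lt hy h

/-! ### Flag chains: reindexing to the slot's `FlagDescent`, and the two properties of Th. 9.18 -/

section Flag

variable {p : ℕ} [Fact p.Prime] {O : Type u} [CommRing O] [IsLocalRing O] [CharP O p] {ℓ : ℕ}
  {frakL : ℕ → Set O} {cot : Set O} {IsGCleaned : O → ℕ → O → Prop}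

/-- [OURS · L1 W2.3] A flag chain sequence, read upwards (`k ↦ c (e − k)`), is a flag descent of the slot
(`CampaignW23.FlagDescent`, p461945). [folklore] -/
theorem IsFlagChainSeq.flagDescent_rev {I : InductionInput p O ℓ} {D : LLChainHead O p frakL cot IsGCleaned}
    {c : ℕ → O} (hc : IsFlagChainSeq I D c) : FlagDescent I (fun k => c (I.e - k)) := by
  intro k hk1 hke
  have h := hc.2.2 (I.e - k) (by omega)
  have e1 : I.e - k + 1 = I.e - (k - 1) := by omega
  have e2 : I.e - (I.e - k) = k := by omega
  rw [e1, e2] at h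
  exact h

/-- [OURS · L1 W2.3] The head of a flag chain sequence, read upwards, is the head datum's `g = y^q + ϵ(0)` at the
bundle's top level. [folklore] -/
theorem IsFlagChainSeq.rev_top {I : InductionInput p O ℓ} {D : LLChainHead O p frakL cot IsGCleaned}
    {c : ℕ → O} (hc : IsFlagChainSeq I D c) : (fun k => c (I.e - k)) I.e = D.y ^ p ^ I.e + D.ε0 := by
  show c (I.e - I.e) = _
  rw [Nat.sub_self, hc.2.1, ← hc.1]
  rfl

/-- [OURS · L1 W2.3] Every member of a flag chain sequence lies in the flag: `c j ∈ Θ(Ě, q(e−j))`, provided the head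
frame's `𝔏(Ě,q(e))` lies in the bundle's top module. In particular the tail `c e ∈ Θ(Ě, q(0))`.
(`mem_theta_ours_of_flagDescent`, p464759.) [folklore] -/
theorem IsFlagChainSeq.mem_theta_ours {I : InductionInput p O ℓ} {D : LLChainHead O p frakL cot IsGCleaned}
    {c : ℕ → O} (hc : IsFlagChainSeq I D c) (hL : frakL (p ^ I.e) ⊆ (I.L I.e : Set O)) {j : ℕ} (hj : j ≤ I.e) :
    c j ∈ I.theta_ours (I.e - j) := by
  have hce : (fun k => c (I.e - k)) I.e ∈ I.L I.e := by
    rw [hc.rev_top]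
    have hm := D.mem_frakL
    rw [hc.1] at hm
    exact hL hm
  have h : c (I.e - (I.e - j)) ∈ I.theta_ours (I.e - j) :=
    mem_theta_ours_of_flagDescent I hce hc.flagDescent_rev (k := I.e - j) (by omega)
  rwa [show I.e - (I.e - j) = j by omega] at h

/-- [OURS · L1 W2.3] The tail of a flag chain sequence lies in the flag bottom `Θ(Ě, q(0))`. [folklore] -/
theorem IsFlagChainSeq.tail_mem_theta_ours_zero {I : InductionInput p O ℓ}
    {D : LLChainHead O p frakL cot IsGCleaned} {c : ℕ → O} (hc : IsFlagChainSeq I D c)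
    (hL : frakL (p ^ I.e) ⊆ (I.L I.e : Set O)) : c D.e ∈ I.theta_ours 0 := by
  have h := hc.mem_theta_ours hL (j := I.e) le_rfl
  rwa [Nat.sub_self, ← hc.1] at h

end Flag

section FlagRegular

variable {p : ℕ} [Fact p.Prime] {O : Type u} [CommRing O] [IsRegularLocalRing O] [CharP O p] {ℓ : ℕ}
  {frakL : ℕ → Set O} {cot : Set O} {IsGCleaned : O → ℕ → O → Prop}

/-- [OURS · L1 W2.3] Th. 9.18 (1), first clause, for a flag chain: `c e − y ∈ max(O_ξ)²` — the slot theorem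
`tailInMSquare_holds` (p466324) read in the typed chain's indexing. [folklore] -/
theorem IsFlagChainSeq.tail_sub_y_mem_sq {I : InductionInput p O ℓ} (hI : ∀ m : ℕ, I.iSing m ≤ maximalIdeal O ^ m)
    {D : LLChainHead O p frakL cot IsGCleaned} {c : ℕ → O} (hc : IsFlagChainSeq I D c) :
    c D.e - D.y ∈ maximalIdeal O ^ 2 := by
  have hε : ((p ^ I.e : ℕ) : ℕ∞) < adicOrder D.ε0 := by rw [← hc.1]; exact D.ord_ε0
  have hε' : D.ε0 ∈ maximalIdeal O ^ (p ^ I.e + 1) := (lt_adicOrder_iff_mem_pow_succ _ _).mp hε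
  have h : c (I.e - 0) - D.y ^ p ^ 0 ∈ maximalIdeal O ^ (p ^ 0 + 1) :=
    flagDescent_sub_pow_mem I hI hε' hc.rev_top hc.flagDescent_rev (k := 0) (Nat.zero_le _)
  rw [Nat.sub_zero, pow_zero, pow_one, ← hc.1] at h
  simpa using h

end FlagRegular

/-- [OURS · L1 W2.3] `Thm918ForFlagChains p` HOLDS for every prime `p`: the typed Th. 9.18 (row 062) instantiated at
the flag chains, `℘̃ := Θ(Ě,q(0))`, and any `𝔳` linked to `cot`, with NO GAP binder. [folklore] -/
theorem thm918ForFlagChains_holds (p : ℕ) [Fact p.Prime] : Thm918ForFlagChains p := by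
  intro O _ _ _ ℓ I hI frakL cot IsGCleaned hL v hcot
  refine ⟨?_, ?_⟩
  · intro D c hc
    exact ⟨hc.tail_sub_y_mem_sq hI, hc.tail_mem_theta_ours_zero hL⟩
  · intro D c hc
    exact toCotangent_ne_zero_and_mem_of_sub_mem_sq hcot (hc.tail_sub_y_mem_sq hI) D.ord_y D.y_mem_cot

/-- [OURS · L1 W2.3] `Thm918ForFlagChainsCotVec p` HOLDS for every prime `p` (row 006's carriers; the Def. 4.15 link
is `Submodule.subset_span`). [folklore] -/
theorem thm918ForFlagChainsCotVec_holds (p : ℕ) [Fact p.Prime] : Thm918ForFlagChainsCotVec p := by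
  intro O _ _ _ ℓ I hI P frakL IsGCleaned hL
  exact thm918ForFlagChains_holds p O ℓ I hI frakL (cotLocal_ours P p : Set O) IsGCleaned hL (cotVec_ours P p)
    (fun f hf hfc => Submodule.subset_span ⟨⟨f, hf⟩, hfc, rfl⟩)

end CampaignW23

end Summit.ResolutionOfSingularities.ResolutionOfSingularities.Theorems
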